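import Summits.KontsevichZagierPeriods.KontsevichZagierPeriods.Theorems.HyperbolicBlochOffTetraSectorKernelBridge
import Summits.KontsevichZagierPeriods.KontsevichZagierPeriods.Theorems.HyperbolicBlochOffTetraSectorKernelStubRaySqrt
import Summits.KontsevichZagierPeriods.KontsevichZagierPeriods.Theorems.HyperbolicBlochOffTetraSectorKernelStubRaySplit
import Summits.KontsevichZagierPeriods.KontsevichZagierPeriods.Theorems.HyperbolicBlochOffTetraSectorKernelStubRayCarriersExist
import Literature.NumberTheory.Transcendental.KZProductIdeal

/-!
# `OffTetraSectorKernel` (stmt-KontsevichZagierPeriods-10557), line `odd-hyperbolic-ladder`: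
stub `stub_rayChain` — `[T(z)] ≡ [Band₁(z)] − [C(z)]·[Λ±(|z|)]`

Registered stub `stub_rayChain` of the crux `OffTetraSectorKernel` (route HyperbolicBloch, skeleton
v11 "the Bloch–Wigner oracle is divisible"): a pure COMPOSITION of landed moves at one point
`z ∈ ℚ̄ ∩ ℍ⁺` with `r = |z|` (`r > 0`, `r² = (Re z)² + (Im z)²`). For every representation `Q` on the
ideal tetrahedron `T(z)` (the set `KZ.idealTetrahedron z`) with integrand `t⁻³` on it, the log band
`B = Band₁(z) = [{0 < s < 1, 1 ≤ u ≤ 1/s}, g(s)/u]`, the arc carrier `C = C(z) = [(0,1), g]`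
(`g(s) = Im z/((1 − s Re z)² + (s Im z)²) = Im (z/(1 − s z))`) and the signed log sheet
`L = Λ±(r) = [{1 < t < r} ∪ {r < t < 1}, sgn(t − 1)/t]`,

  `[Q] − [B] + [C]·[L] ∈ KZ.relations`.

The chain: `[Q] ∼ [Δ(z), Im z/(2 pw)]` (`tetraFlatten`, a flat shadow from `exists_flatRep`)
`∼ KZ.rayDilogRep (Re z) (Im z)` (`rayMeetsShadow`; together the Milnor bridge)
`≡ [Ray₁(z, r)]` (`stub_raySqrt`, the square-rooted ray carrier of `stub_rayCarriersExist`)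
`≡ [Band₁(z)] − [C × Λ±(r)]` (`stub_raySplit` with `P := C.prod L`, whose domain is
`(0,1) × ({1 < t < r} ∪ {r < t < 1})` and whose integrand is `g ⊗ (sgn(t − 1)/t)` by
`KZ.IntegralRep.prod_integrand_eq`), and `[C]·[L] = [C.prod L]` (`KZ.of_mul_of`).

References: D. Zagier, *The dilogarithm function* (2007), Ch. I §3; J. Milnor, *Hyperbolic geometry:
the first 150 years* (1982), Appendix; M. Kontsevich, D. Zagier, *Periods* (2001), §1.2, §4.1.
No definitions are introduced.
-/

noncomputable section

open Set MeasureTheory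
open Literature.NumberTheory.Transcendental

namespace Summit.KontsevichZagierPeriods.HyperbolicBloch.OffTetraSectorKernel

/-- The domain of the product `C.prod L` of the arc carrier `C = [(0,1), g]` and the signed log sheet
`L = [{1 < t < r} ∪ {r < t < 1}, sgn(t − 1)/t]` is `{0 < s < 1, v strictly between 1 and r}`
(`Fin.castAdd 1 0 = 0`, `Fin.natAdd 1 0 = 1`). [cite: KontsevichZagier2001, §4.1] -/
theorem rayChain_prod_domain (r : ℝ) (C L : KZ.IntegralRep 1)
    (hC : C.domain = {t | 0 < t 0 ∧ t 0 < 1})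
    (hL : L.domain = {t | (1 < t 0 ∧ t 0 < r) ∨ (r < t 0 ∧ t 0 < 1)}) :
    (C.prod L).domain =
      {w : Fin 2 → ℝ | (0 < w 0 ∧ w 0 < 1) ∧ ((1 < w 1 ∧ w 1 < r) ∨ (r < w 1 ∧ w 1 < 1))} := by
  ext w
  rw [KZ.IntegralRep.prod_domain, KZ.IntegralRep.mem_prodDomain, hC, hL]
  rfl

/-- The integrand of the product `C.prod L` of the arc carrier and the signed log sheet is
`g(s) · (sgn(v − 1)/v)` on its domain (`KZ.IntegralRep.prod_integrand_eq`: the integrand of a product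
representation is the tensor product of the integrands). [cite: KontsevichZagier2001, §4.1] -/
theorem rayChain_prod_integrand (z : ℂ) (C L : KZ.IntegralRep 1)
    (hCi : Set.EqOn C.integrand (fun t => z.im / ((1 - t 0 * z.re) ^ 2 + (t 0 * z.im) ^ 2)) C.domain)
    (hLi : Set.EqOn L.integrand (fun t => (if 1 < t 0 then (1 : ℝ) else -1) / t 0) L.domain) :
    Set.EqOn (C.prod L).integrand
      (fun w : Fin 2 → ℝ => z.im / ((1 - w 0 * z.re) ^ 2 + (w 0 * z.im) ^ 2) *
        ((if 1 < w 1 then (1 : ℝ) else -1) / w 1)) (C.prod L).domain := by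
  intro w hw
  have hwC : (fun i : Fin 1 => w (Fin.castAdd 1 i)) ∈ C.domain := hw.1
  have hwL : (fun j : Fin 1 => w (Fin.natAdd 1 j)) ∈ L.domain := hw.2
  rw [KZ.IntegralRep.prod_integrand_eq, KZ.IntegralRep.prodFun_apply, hCi hwC, hLi hwL]
  rfl

/-- **STUB `stub_rayChain`** (composition of landed moves, one point): for algebraic `z ∈ ℍ⁺` with
`r = |z|`, every representation `[T(z), t⁻³]` satisfies `[T(z)] ≡ [Band₁(z)] − [C(z)]·[Λ±(r)]` modulo
relations: the Milnor bridge (`tetraFlatten`, `rayMeetsShadow` to `KZ.rayDilogRep`), `stub_raySqrt`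
(to the square-rooted ray carrier of `stub_rayCarriersExist`), `stub_raySplit` with `P := C.prod L`
(`KZ.of_mul_of`, `KZ.IntegralRep.prod_integrand_eq`). [cite: Zagier2007Dilogarithm, Ch. I §3] -/
theorem stub_rayChain :
    ∀ (z : ℂ), IsAlgebraic ℚ z → 0 < z.im → ∀ (r : ℝ), IsAlgebraic ℚ r → 0 < r → r ^ 2 = z.re ^ 2 + z.im ^ 2 →
    ∀ (Q : KZ.IntegralRep 3) (B : KZ.IntegralRep 2) (C L : KZ.IntegralRep 1),
      Q.domain = {p | 0 < p 1 ∧ z.re * p 1 < z.im * p 0 ∧ z.im * (p 0 - 1) < (z.re - 1) * p 1 ∧ 0 < p 2 ∧ 0 < z.im * (p 0 ^ 2 + p 1 ^ 2 + p 2 ^ 2 - p 0) + (z.re - Complex.normSq z) * p 1} →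
      Set.EqOn Q.integrand (fun p => 1 / p 2 ^ 3) Q.domain →
      B.domain = {w | (0 < w 0 ∧ w 0 < 1) ∧ 1 ≤ w 1 ∧ w 1 ≤ 1 / w 0} →
      Set.EqOn B.integrand (fun w => z.im / ((1 - w 0 * z.re) ^ 2 + (w 0 * z.im) ^ 2) / w 1) B.domain →
      C.domain = {t | 0 < t 0 ∧ t 0 < 1} →
      Set.EqOn C.integrand (fun t => z.im / ((1 - t 0 * z.re) ^ 2 + (t 0 * z.im) ^ 2)) C.domain →
      L.domain = {t | (1 < t 0 ∧ t 0 < r) ∨ (r < t 0 ∧ t 0 < 1)} →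
      Set.EqOn L.integrand (fun t => (if 1 < t 0 then (1 : ℝ) else -1) / t 0) L.domain →
      KZ.of Q - KZ.of B + KZ.of C * KZ.of L ∈ KZ.relations := by
  intro z hz him r hr hr0 hr2 Q B C L hQ hQi hB hBi hC hCi hL hLi
  have hre : IsAlgebraic ℚ z.re := (isAlgebraic_re_im hz).1
  have him' : IsAlgebraic ℚ z.im := (isAlgebraic_re_im hz).2
  -- (1) the Milnor bridge: `[Q] ∼ [flat shadow] ∼ rayDilogRep`
  obtain ⟨s, hs, hsi⟩ := exists_flatRep z hz him
  have hQ' : Q.domain = idealTetrahedron z := hQ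
  have h1 : KZ.of Q - KZ.of s ∈ KZ.relations := tetraFlatten z hz him Q s hQ' hQi hs hsi
  have h2 : KZ.of s - KZ.of (KZ.rayDilogRep z.re z.im hre him') ∈ KZ.relations :=
    rayMeetsShadow z hz him s (KZ.rayDilogRep z.re z.im hre him') hs hsi rfl (fun _ _ => rfl)
  -- (2) the substitution `u = v²`: `rayDilogRep ≡ Ray₁`
  obtain ⟨R₁, hR₁d, hR₁int⟩ := stub_rayCarriersExist.2.2 z.re z.im r hre him' hr him hr0
  have hR₁i : Set.EqOn R₁.integrand
      (fun w => (if 1 < w 1 then (1 : ℝ) else -1) * (-z.im) /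
        (w 1 * ((1 - w 0 * z.re) ^ 2 + (w 0 * z.im) ^ 2))) R₁.domain := by
    intro w _
    rw [hR₁int]
  have h3 : KZ.of (KZ.rayDilogRep z.re z.im hre him') - KZ.of R₁ ∈ KZ.relations :=
    stub_raySqrt z.re z.im r hre him' hr him hr0 hr2 (KZ.rayDilogRep z.re z.im hre him') R₁ rfl
      (fun _ _ => rfl) hR₁d hR₁i
  -- (3) the split `Ray₁ ≡ Band₁ − C × Λ±`
  have hPd := rayChain_prod_domain r C L hC hL
  have hPi := rayChain_prod_integrand z C L hCi hLi
  have h4 : KZ.of R₁ - KZ.of B + KZ.of (C.prod L) ∈ KZ.relations :=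
    stub_raySplit z.re z.im r hre him' hr him hr0 hr2 R₁ B (C.prod L) hR₁d hR₁i hB hBi hPd hPi
  -- (4) sum up
  rw [KZ.of_mul_of]
  have key : KZ.of Q - KZ.of B + KZ.of (C.prod L) =
      (KZ.of Q - KZ.of s) + (KZ.of s - KZ.of (KZ.rayDilogRep z.re z.im hre him')) +
        (KZ.of (KZ.rayDilogRep z.re z.im hre him') - KZ.of R₁) +
        (KZ.of R₁ - KZ.of B + KZ.of (C.prod L)) := by
    abel
  rw [key]
  exact add_mem (add_mem (add_mem h1 h2) h3) h4

end Summit.KontsevichZagierPeriods.HyperbolicBloch.OffTetraSectorKernel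

end
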